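import Summits.QuantumFields.YangMills.Theorems.WilsonVillainDualStiffnessHartmanWatsonMixtureArcMass
import Literature.Analysis.FunctionSpaces.BesselIIntegralSeries
import Mathlib.Analysis.SpecialFunctions.Trigonometric.Bounds
import Mathlib.Analysis.Real.Pi.Bounds
import HarnessLib

/-!
# Route `WilsonVillainDualStiffness` / `WilsonVillainPerimeterTransfer`, shared crux stmt-QuantumFields-26809
# `HartmanWatsonMixture`: the registered stub `stub_tailFromArcBound` (dual witness ⇒ hot-set tail for EVERY mixing measure)

Stub `stub_tailFromArcBound` of the registered BC3 skeleton v2 of the shared crux `HartmanWatsonMixture` (planner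
`ym-idea-3` g6, birth file `HartmanWatsonMixture_birth_v2.lean`, sha256 a1776bf4…), with the REGISTERED signature verbatim
(`arcMass` from the D-0016 Defs companion, p659005).  Together with `ArcMass.stub_arcMassLowerBound` (p659513) this leaves the
crux's skeleton with ONE open stub, `stub_mixingMeasureExists` = the named fact Hartman–Watson 1974
(`Literature.Probability.HartmanWatson1974.HartmanWatsonLaw`, Yor's density; XL, not expected in the tree).

STATEMENT.  If the witness-arc mass obeys the two-regime floor `min (g a) ((1/20)/π) ≤ arcMass t` for `0 < a ≤ 33/10 ≤ …`,
`t ≥ a`, then there is `β₀` (here `β₀ = 200`) such that for every `β > β₀` and EVERY finite measure `Θ` on `ℝ` carried by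
`(0, ∞)` with the integer Gaussian moments `(1/π)∫₀^π e^{β cos θ} cos(kθ) dθ = ∫ e^{-k²t/2} dΘ` (`k ∈ ℤ`), the hot set is
exponentially small: `Θ{t > 1/((2/5)β)} ≤ e^{-(2/5)β} · Θ(ℝ)`.

PROOF (the planner's dual witness `u = 1 − 1_J/m`, critic idea-crit-4 09:10:32Z).
* §1 `isMixingMeasure_of_moments`: the item's clause IS `IsMixingMeasure β Θ` of `VonMisesMixture.lean` — the left side is the
  integral-defined `I_{|k|}(β)` (`FunctionSpaces.besselI`), equal to the series-defined `I_k(β)` by the tree's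
  `latticeModels_besselI_eq_besselI_natAbs` and the evenness `cos(kθ) = cos(|k|θ)`.
* §2 `measureReal_univ_ge`: `Θ(ℝ) = I₀(β) = (1/π)∫₀^π e^{β cos θ}dθ ≥ (3/(10π)) e^{β cos(3/10)}` (restrict to `θ ≤ 3/10`;
  `cos` is decreasing on `[0, π]`).
* §3 `lintegral_lintegral_arc`: TONELLI in `ℝ≥0∞` for `(t, θ) ↦ p_t(e^{iθ})` against `Θ ⊗ dθ|_J`: the kernel is jointly
  continuous on `(0,∞) × U(1)` (tree `continuousOn_uncurry_circleHeatKernel`) and `Θ` is carried by `(0,∞)`, so the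
  uncurried integrand is a.e.-measurable on the product (`Measure.prod_restrict`); the inner `t`-integral is the
  Hartman–Watson DICTIONARY `∫ p_t(e^{iθ}) dΘ(t) = e^{β cos θ}` (tree `IsMixingMeasure.integral_circleHeatKernel`).
* §4 numerical constants: `cos(104/50) ≤ −873/2000` (`cos x = −cos(π−x)`, `cos y ≥ 1 − y²/2`, `π < 3.1416`),
  `cos(3/10) ≥ 191/200`; on `J`, `cos θ ≤ cos(104/50)`.
* §5 `stub_tailFromArcBound`: with `a = 1/((2/5)β)` and `m = min (g a) ((1/20)/π) > 0`, pointwise `1_{t>a} ≤ arcMass t / m`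
  (the arc floor), so `Θ{t > a} ≤ (1/(2πm)) ∫∫_J p_t dθ dΘ = (1/(2πm)) ∫_J e^{β cos θ} dθ ≤ e^{β cos(104/50)}/(10π m)`
  (`|J| = 1/5`); and `m ≥ e^{-(109/50)²β/5}/68` (`√(2πa) ≤ 1`, `20π ≤ 63`), `Θ(ℝ) ≥ (3/(10π))e^{β cos(3/10)}`, so the claim
  follows from `68 e^{β(cos(104/50) + (109/50)²/5)} ≤ 3 e^{β(cos(3/10) − 2/5)}`, i.e. from the exponent gap
  `cos(3/10) − 2/5 − cos(104/50) − (109/50)²/5 ≥ 0.041` and `β > 200` (`e^{8.2} ≥ 1 + 8.2 + 8.2²/2 ≥ 68/3`).  The exact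
  large-deviation rate of the method is `sup_θ[(1 − cos θ) − c₀θ²/2]`, threshold `c₀* ≈ 0.472 > 2/5` (planner's note).

Honest label: an elementary stub of an OPEN crux on DRAFT-by-design routes (nodes `U1HelicityGapTorusD4`,
`AbelianDeconfinementD4`); nothing about the Hartman–Watson law itself (existence of `Θ`), the crux, the nodes or any summit
statement is proved here.  No named facts; no `sorry`; default heartbeats.  Seat `ym-line-frs-p2` g9 (free hands, announced
on the owner's bus 2026-08-28), `--supports stmt-QuantumFields-26809`.

References: P. Hartman, G. S. Watson, Ann. Probab. 2 (1974) 593–607; E. M. Stein, *Topics in Harmonic Analysis* (1970),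
Ch. II §2; DLMF 10.32.3.
-/

noncomputable section

namespace Summit.QuantumFields.YangMills.Cruxes.HartmanWatsonMixture

namespace Tail

open MeasureTheory Set Filter
open scoped ENNReal
open Literature.MathematicalPhysics.QuantumLattice (circleHeatKernel circleHeatKernel_nonneg
  continuous_circleHeatKernel continuousOn_uncurry_circleHeatKernel)
open Literature.Probability.HartmanWatson1974 (IsMixingMeasure)
open ArcMass (ite_mul_eq_indicator)

/-! ## §1 The item's moment clause makes `Θ` a Hartman–Watson mixing measure -/

/-- `cos(kθ) = cos(|k|θ)` for an integer `k` (evenness of `cos`). -/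
theorem cos_intCast_mul (k : ℤ) (θ : ℝ) : Real.cos ((k : ℝ) * θ) = Real.cos ((k.natAbs : ℝ) * θ) := by
  rcases Int.natAbs_eq k with h | h
  · conv_lhs => rw [h]
    rw [Int.cast_natCast]
  · conv_lhs => rw [h]
    rw [Int.cast_neg, Int.cast_natCast, neg_mul, Real.cos_neg]

/-- The item's hypotheses (finite, carried by `(0,∞)`, `(1/π)∫₀^π e^{β cos θ}cos(kθ) dθ = ∫ e^{-k²t/2} dΘ` for all `k ∈ ℤ`)
are exactly `IsMixingMeasure β Θ` (the left side is the integral-defined `I_{|k|}(β)` = the series-defined `I_k(β)`,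
tree `latticeModels_besselI_eq_besselI_natAbs`). -/
theorem isMixingMeasure_of_moments {β : ℝ} {Θ : Measure ℝ} (hfin : IsFiniteMeasure Θ) (h0 : Θ (Set.Iic 0) = 0)
    (hmom : ∀ k : ℤ, ((∫ θ in (0:ℝ)..Real.pi, Real.exp (β * Real.cos θ) * Real.cos (((k : ℤ) : ℝ) * θ)) / Real.pi) =
      ∫ t, Real.exp (-(((k : ℝ) ^ 2) * t) / 2) ∂Θ) :
    IsMixingMeasure β Θ where
  finite := hfin
  null_nonpos := h0
  laplace k := by
    have hfun : (fun t => Real.exp (-(k : ℝ) ^ 2 * t / 2)) = fun t => Real.exp (-(((k : ℝ) ^ 2) * t) / 2) := by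
      funext t; ring_nf
    rw [hfun, ← hmom k, Literature.Analysis.FunctionSpaces.latticeModels_besselI_eq_besselI_natAbs,
      Literature.Analysis.FunctionSpaces.besselI, div_eq_inv_mul]
    congr 1
    refine intervalIntegral.integral_congr (fun θ _ => ?_)
    simp only [cos_intCast_mul k θ]

/-! ## §2 The total mass `Θ(ℝ) = I₀(β)` from below -/

/-- `I₀(β) = (1/π)∫₀^π e^{β cos θ} dθ ≥ (3/(10π))·e^{β cos(3/10)}` (`β ≥ 0`; restrict to `θ ≤ 3/10`, `cos` decreasing on `[0, π]`). -/
theorem measureReal_univ_ge {β : ℝ} {Θ : Measure ℝ} (hβ : 0 ≤ β) (h : IsMixingMeasure β Θ) :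
    3 / (10 * Real.pi) * Real.exp (β * Real.cos (3 / 10)) ≤ Θ.real Set.univ := by
  rw [h.measureReal_univ, Literature.Analysis.FunctionSpaces.latticeModels_besselI_eq_besselI_natAbs,
    show (0 : ℤ).natAbs = 0 from rfl, Literature.Analysis.FunctionSpaces.besselI_zero_eq,
    intervalIntegral.integral_of_le Real.pi_pos.le]
  have hπ := Real.pi_pos
  have h3π : (3 / 10 : ℝ) ≤ Real.pi := by linarith [Real.pi_gt_three]
  have hcont : Continuous fun θ : ℝ => Real.exp (β * Real.cos θ) := by fun_prop
  have hsub : ∫ θ in Set.Ioc (0 : ℝ) (3 / 10), Real.exp (β * Real.cos θ) ≤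
      ∫ θ in Set.Ioc (0 : ℝ) Real.pi, Real.exp (β * Real.cos θ) :=
    setIntegral_mono_set (hcont.integrableOn_Icc.mono_set Set.Ioc_subset_Icc_self)
      (Eventually.of_forall fun θ => (Real.exp_pos _).le) (Set.Ioc_subset_Ioc_right h3π).eventuallyLE
  have hlow : Real.exp (β * Real.cos (3 / 10)) * (3 / 10) ≤ ∫ θ in Set.Ioc (0 : ℝ) (3 / 10), Real.exp (β * Real.cos θ) := by
    have h1 := setIntegral_ge_of_const_le_real (μ := volume) (s := Set.Ioc (0 : ℝ) (3 / 10))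
      (f := fun θ => Real.exp (β * Real.cos θ)) (c := Real.exp (β * Real.cos (3 / 10))) measurableSet_Ioc
      (by rw [Real.volume_Ioc]; exact ENNReal.ofReal_ne_top)
      (fun θ hθ => Real.exp_le_exp.2 (mul_le_mul_of_nonneg_left
        (Real.cos_le_cos_of_nonneg_of_le_pi hθ.1.le h3π hθ.2) hβ))
      (hcont.integrableOn_Icc.mono_set Set.Ioc_subset_Icc_self)
    rwa [measureReal_def, Real.volume_Ioc, ENNReal.toReal_ofReal (by norm_num), sub_zero] at h1
  calc 3 / (10 * Real.pi) * Real.exp (β * Real.cos (3 / 10))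
      = Real.pi⁻¹ * (Real.exp (β * Real.cos (3 / 10)) * (3 / 10)) := by ring
    _ ≤ Real.pi⁻¹ * ∫ θ in Set.Ioc (0 : ℝ) Real.pi, Real.exp (β * Real.cos θ) :=
        mul_le_mul_of_nonneg_left (hlow.trans hsub) (inv_nonneg.2 hπ.le)

/-! ## §3 Tonelli + the Hartman–Watson dictionary on the arc -/

/-- For a mixing measure `Θ` at `β`: `∫ (∫⁻_J p_t(e^{iθ}) dθ) dΘ(t) = ∫⁻_J e^{β cos θ} dθ` (Tonelli for the jointly continuous
kernel on `(0,∞) × J`, `Θ` carried by `(0,∞)`; inner integral by `IsMixingMeasure.integral_circleHeatKernel`). -/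
theorem lintegral_lintegral_arc {β : ℝ} {Θ : Measure ℝ} (h : IsMixingMeasure β Θ) {J : Set ℝ} (hJ : MeasurableSet J) :
    ∫⁻ t, (∫⁻ θ in J, ENNReal.ofReal (circleHeatKernel t (Circle.exp θ))) ∂Θ =
      ∫⁻ θ in J, ENNReal.ofReal (Real.exp (β * Real.cos θ)) := by
  haveI := h.finite
  have hΘ : Θ.restrict (Set.Ioi 0) = Θ :=
    Measure.restrict_eq_self_of_ae_mem (by filter_upwards [h.ae_pos] with t ht; exact ht)
  have hcont : ContinuousOn (Function.uncurry fun (t θ : ℝ) => circleHeatKernel t (Circle.exp θ))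
      (Set.Ioi (0 : ℝ) ×ˢ J) := by
    have h1 : ContinuousOn (Function.uncurry circleHeatKernel) (Set.Ioi (0 : ℝ) ×ˢ Set.univ) :=
      continuousOn_uncurry_circleHeatKernel
    have h2 : Continuous fun p : ℝ × ℝ => (p.1, Circle.exp p.2) := by fun_prop
    have h3 := h1.comp h2.continuousOn (fun p (hp : p ∈ Set.Ioi (0 : ℝ) ×ˢ J) => ⟨hp.1, Set.mem_univ _⟩)
    exact h3
  have hae : AEMeasurable (Function.uncurry fun (t θ : ℝ) => ENNReal.ofReal (circleHeatKernel t (Circle.exp θ)))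
      (Θ.prod (volume.restrict J)) := by
    have hprod : Θ.prod (volume.restrict J) = (Θ.prod volume).restrict (Set.Ioi 0 ×ˢ J) := by
      conv_lhs => rw [← hΘ]
      exact Measure.prod_restrict _ _
    rw [hprod]
    exact (hcont.aemeasurable (measurableSet_Ioi.prod hJ)).ennreal_ofReal
  calc ∫⁻ t, (∫⁻ θ in J, ENNReal.ofReal (circleHeatKernel t (Circle.exp θ))) ∂Θ
      = ∫⁻ θ in J, (∫⁻ t, ENNReal.ofReal (circleHeatKernel t (Circle.exp θ)) ∂Θ) := lintegral_lintegral_swap hae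
    _ = ∫⁻ θ in J, ENNReal.ofReal (Real.exp (β * Real.cos θ)) := by
        refine setLIntegral_congr_fun hJ (fun θ _ => ?_)
        have hint : Integrable (fun t => circleHeatKernel t (Circle.exp θ)) Θ :=
          Integrable.of_integral_ne_zero (by rw [h.integral_circleHeatKernel θ]; exact (Real.exp_pos _).ne')
        have hnn : 0 ≤ᵐ[Θ] fun t => circleHeatKernel t (Circle.exp θ) := by
          filter_upwards [h.ae_pos] with t ht
          exact circleHeatKernel_nonneg ht _
        rw [← ofReal_integral_eq_lintegral_ofReal hint hnn, h.integral_circleHeatKernel θ]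

/-! ## §4 Numerical constants -/

/-- `cos(104/50) ≤ −873/2000` (`cos x = −cos(π − x)`, `cos y ≥ 1 − y²/2`, `π − 104/50 ≤ 1.0616`). -/
theorem cos_arc_le : Real.cos (104 / 50) ≤ -(873 / 2000 : ℝ) := by
  have hx : Real.cos (104 / 50) = -Real.cos (Real.pi - 104 / 50) := by
    rw [Real.cos_pi_sub]; ring
  have h1 := Real.one_sub_sq_div_two_le_cos (x := Real.pi - 104 / 50)
  have hπ1 : Real.pi - 104 / 50 ≤ 1.0616 := by linarith [Real.pi_lt_d4]
  have hπ2 : 0 ≤ Real.pi - 104 / 50 := by linarith [Real.pi_gt_three]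
  have h2 : (Real.pi - 104 / 50) ^ 2 ≤ 1.0616 ^ 2 := pow_le_pow_left₀ hπ2 hπ1 2
  rw [hx]
  norm_num at h2 ⊢
  linarith

/-- `cos(3/10) ≥ 191/200`. -/
theorem cos_three_tenths_ge : (191 / 200 : ℝ) ≤ Real.cos (3 / 10) := by
  have := Real.one_sub_sq_div_two_le_cos (x := (3 / 10 : ℝ))
  norm_num at this
  linarith

/-- On the arc `J`, `cos θ ≤ cos(104/50)`. -/
theorem cos_le_on_arc {θ : ℝ}
    (hθ : θ ∈ Set.Icc (-(109 / 50 : ℝ)) (-(104 / 50)) ∪ Set.Icc (104 / 50 : ℝ) (109 / 50)) :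
    Real.cos θ ≤ Real.cos (104 / 50) := by
  have habs : 104 / 50 ≤ |θ| ∧ |θ| ≤ 109 / 50 := by
    rcases hθ with ⟨h1, h2⟩ | ⟨h1, h2⟩
    · rw [abs_of_neg (by linarith)]; exact ⟨by linarith, by linarith⟩
    · rw [abs_of_nonneg (by linarith)]; exact ⟨h1, h2⟩
  rw [← Real.cos_abs θ]
  exact Real.cos_le_cos_of_nonneg_of_le_pi (by norm_num) (by linarith [Real.pi_gt_three, habs.2]) habs.1

/-! ## §5 The registered stub -/

/-- **The registered stub `stub_tailFromArcBound` of crux stmt-QuantumFields-26809** (skeleton v2, sha a1776bf4…), VERBATIM: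
the arc-mass lower bound implies the hot-set tail `Θ{t > 1/(c₀β)} ≤ e^{-c₀β}·Θ(ℝ)`, `c₀ = 2/5`, for EVERY admissible
mixing measure and all `β > β₀ = 200` (dual witness `u = 1 − 1_J/m`). -/
theorem stub_tailFromArcBound :
    (∀ a : ℝ, 0 < a → a ≤ 33 / 10 → ∀ t : ℝ, a ≤ t → min ((1 / 5) / Real.sqrt (2 * Real.pi * a) * Real.exp (-((109 / 50) ^ 2) / (2 * a))) ((1 / 20) / Real.pi) ≤ arcMass t) →
    ∃ β₀ : ℝ, ∀ β : ℝ, β₀ < β → ∀ Θ : MeasureTheory.Measure ℝ, MeasureTheory.IsFiniteMeasure Θ → Θ (Set.Iic 0) = 0 → (∀ k : ℤ, ((∫ θ in (0:ℝ)..Real.pi, Real.exp (β * Real.cos θ) * Real.cos (((k : ℤ) : ℝ) * θ)) / Real.pi) = ∫ t, Real.exp (-(((k : ℝ) ^ 2) * t) / 2) ∂Θ) → Θ {t : ℝ | 1 / ((2 / 5) * β) < t} ≤ ENNReal.ofReal (Real.exp (-((2 / 5) * β))) * Θ Set.univ := by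
  intro harc
  refine ⟨200, fun β hβ Θ hfin h0 hmom => ?_⟩
  have hmix : IsMixingMeasure β Θ := isMixingMeasure_of_moments hfin h0 hmom
  haveI := hfin
  have hπ : 0 < Real.pi := Real.pi_pos
  have hβ0 : 0 < β := by linarith
  set a : ℝ := 1 / ((2 / 5) * β) with ha_def
  have ha0 : 0 < a := by positivity
  have ha33 : a ≤ 33 / 10 := by
    rw [ha_def, div_le_iff₀ (by positivity)]; nlinarith
  -- the witness amplitude
  set m : ℝ := min ((1 / 5) / Real.sqrt (2 * Real.pi * a) * Real.exp (-((109 / 50) ^ 2) / (2 * a)))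
    ((1 / 20) / Real.pi) with hm_def
  have hsqrt_pos : 0 < Real.sqrt (2 * Real.pi * a) := Real.sqrt_pos.2 (by positivity)
  have hg0 : 0 < (1 / 5) / Real.sqrt (2 * Real.pi * a) * Real.exp (-((109 / 50) ^ 2) / (2 * a)) := by positivity
  have hm0 : 0 < m := lt_min hg0 (by positivity)
  have harc' : ∀ t, a ≤ t → m ≤ arcMass t := fun t ht => harc a ha0 ha33 t ht
  -- the arc
  set J : Set ℝ := Set.Icc (-(109 / 50 : ℝ)) (-(104 / 50)) ∪ Set.Icc (104 / 50 : ℝ) (109 / 50) with hJ_def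
  have hJm : MeasurableSet J := measurableSet_Icc.union measurableSet_Icc
  have hJsub : J ⊆ Set.Icc (-Real.pi) Real.pi := by
    rintro θ (⟨h1, h2⟩ | ⟨h1, h2⟩) <;> exact ⟨by linarith [Real.pi_gt_three], by linarith [Real.pi_gt_three]⟩
  have hvolJ : volume J ≤ ENNReal.ofReal (1 / 5) := by
    refine (measure_union_le _ _).trans (le_of_eq ?_)
    rw [Real.volume_Icc, Real.volume_Icc, ← ENNReal.ofReal_add (by norm_num) (by norm_num)]
    norm_num
  -- Step 1: the indicator of the hot set is below `arcMass/m`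
  have step1 : Θ {t : ℝ | a < t} ≤ ∫⁻ t, ENNReal.ofReal (arcMass t / m) ∂Θ := by
    change Θ (Set.Ioi a) ≤ _
    rw [← lintegral_indicator_one (measurableSet_Ioi : MeasurableSet (Set.Ioi a))]
    refine lintegral_mono (fun t => ?_)
    by_cases ht : t ∈ Set.Ioi a
    · rw [Set.indicator_of_mem ht, Pi.one_apply, ← ENNReal.ofReal_one]
      exact ENNReal.ofReal_le_ofReal (by rw [le_div_iff₀ hm0, one_mul]; exact harc' t (le_of_lt ht))
    · rw [Set.indicator_of_notMem ht]; exact bot_le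
  -- Step 2: `arcMass t / m` as a Lebesgue integral over the arc (t > 0)
  have step2 : ∀ t : ℝ, 0 < t → ENNReal.ofReal (arcMass t / m) =
      ENNReal.ofReal (1 / (2 * Real.pi * m)) * ∫⁻ θ in J, ENNReal.ofReal (circleHeatKernel t (Circle.exp θ)) := by
    intro t ht
    have hcont : Continuous fun θ : ℝ => circleHeatKernel t (Circle.exp θ) :=
      (continuous_circleHeatKernel ht).comp Circle.exp.continuous
    have hintJ : IntegrableOn (fun θ : ℝ => circleHeatKernel t (Circle.exp θ)) J volume :=
      hcont.integrableOn_Icc.union hcont.integrableOn_Icc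
    have harc_eq : arcMass t = (∫ θ in J, circleHeatKernel t (Circle.exp θ)) / (2 * Real.pi) := by
      rw [arcMass_def, setIntegral_congr_fun measurableSet_Icc
          (fun θ _ => ite_mul_eq_indicator (fun θ => circleHeatKernel t (Circle.exp θ)) θ),
        setIntegral_indicator hJm, Set.inter_eq_right.2 hJsub]
    rw [harc_eq]
    rw [show (∫ θ in J, circleHeatKernel t (Circle.exp θ)) / (2 * Real.pi) / m =
        1 / (2 * Real.pi * m) * ∫ θ in J, circleHeatKernel t (Circle.exp θ) by field_simp,
      ENNReal.ofReal_mul (by positivity),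
      ofReal_integral_eq_lintegral_ofReal hintJ (Eventually.of_forall fun θ => circleHeatKernel_nonneg ht _)]
  -- Step 3: the real inequality behind the last step
  have hreal : Real.exp (β * Real.cos (104 / 50)) / (10 * Real.pi * m) ≤
      Real.exp (-((2 / 5) * β)) * Θ.real Set.univ := by
    -- `m ≥ e^{-(109/50)²β/5}/68`
    have hexp_a : Real.exp (-((109 / 50) ^ 2) / (2 * a)) = Real.exp (-((109 / 50) ^ 2 * β / 5)) := by
      congr 1
      rw [ha_def]
      field_simp
    have hsqrt_le : Real.sqrt (2 * Real.pi * a) ≤ 1 := by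
      rw [Real.sqrt_le_one, ha_def,
        show 2 * Real.pi * (1 / (2 / 5 * β)) = 5 * Real.pi / β by field_simp, div_le_one hβ0]
      linarith [Real.pi_lt_d2]
    have hg_ge : (1 / 5) * Real.exp (-((109 / 50) ^ 2 * β / 5)) ≤
        (1 / 5) / Real.sqrt (2 * Real.pi * a) * Real.exp (-((109 / 50) ^ 2) / (2 * a)) := by
      rw [hexp_a]
      refine mul_le_mul_of_nonneg_right ?_ (Real.exp_pos _).le
      rw [le_div_iff₀ hsqrt_pos]
      nlinarith [hsqrt_le]
    have hE1 : Real.exp (-((109 / 50) ^ 2 * β / 5)) ≤ 1 := by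
      rw [Real.exp_le_one_iff]
      have : 0 ≤ (109 / 50 : ℝ) ^ 2 * β / 5 := by positivity
      linarith
    have hm_ge : (1 / 68) * Real.exp (-((109 / 50) ^ 2 * β / 5)) ≤ m := by
      rcases min_choice ((1 / 5) / Real.sqrt (2 * Real.pi * a) * Real.exp (-((109 / 50) ^ 2) / (2 * a)))
        ((1 / 20) / Real.pi) with hmin | hmin
      · rw [hm_def, hmin]
        exact le_trans (by linarith [Real.exp_pos (-((109 / 50 : ℝ) ^ 2 * β / 5))]) hg_ge
      · rw [hm_def, hmin, le_div_iff₀ hπ]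
        nlinarith [Real.pi_lt_d2, Real.exp_pos (-((109 / 50 : ℝ) ^ 2 * β / 5)),
          mul_nonneg (sub_nonneg.2 hE1) hπ.le]
    -- the exponent gap: `cos(3/10) − 2/5 − cos(104/50) − (109/50)²/5 ≥ 0.041`, times `β > 200`
    have e1 : β * Real.cos (104 / 50) ≤ β * (-(873 / 2000)) := mul_le_mul_of_nonneg_left cos_arc_le hβ0.le
    have e2 : β * (191 / 200) ≤ β * Real.cos (3 / 10) := mul_le_mul_of_nonneg_left cos_three_tenths_ge hβ0.le
    have hgap : 41 / 5 ≤ (β * Real.cos (3 / 10) - 2 / 5 * β) -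
        (β * Real.cos (104 / 50) + (109 / 50) ^ 2 * β / 5) := by
      nlinarith [e1, e2, hβ]
    have hq := Real.quadratic_le_exp_of_nonneg (show (0 : ℝ) ≤ (β * Real.cos (3 / 10) - 2 / 5 * β) -
        (β * Real.cos (104 / 50) + (109 / 50) ^ 2 * β / 5) by linarith)
    have h683 : (68 / 3 : ℝ) ≤ Real.exp ((β * Real.cos (3 / 10) - 2 / 5 * β) -
        (β * Real.cos (104 / 50) + (109 / 50) ^ 2 * β / 5)) := by
      nlinarith [hq, hgap, sq_nonneg ((β * Real.cos (3 / 10) - 2 / 5 * β) -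
        (β * Real.cos (104 / 50) + (109 / 50) ^ 2 * β / 5) - 41 / 5)]
    have hPQ : 68 * Real.exp (β * Real.cos (104 / 50) + (109 / 50) ^ 2 * β / 5) ≤
        3 * Real.exp (β * Real.cos (3 / 10) - 2 / 5 * β) := by
      have hsplit : Real.exp (β * Real.cos (3 / 10) - 2 / 5 * β) =
          Real.exp ((β * Real.cos (3 / 10) - 2 / 5 * β) - (β * Real.cos (104 / 50) + (109 / 50) ^ 2 * β / 5)) *
            Real.exp (β * Real.cos (104 / 50) + (109 / 50) ^ 2 * β / 5) := by
        rw [← Real.exp_add]; ring_nf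
      rw [hsplit]
      nlinarith [h683, Real.exp_pos (β * Real.cos (104 / 50) + (109 / 50) ^ 2 * β / 5)]
    have hΘ := measureReal_univ_ge hβ0.le hmix
    have hm0' : 0 < 10 * Real.pi * ((1 / 68) * Real.exp (-((109 / 50) ^ 2 * β / 5))) := by positivity
    calc Real.exp (β * Real.cos (104 / 50)) / (10 * Real.pi * m)
        ≤ Real.exp (β * Real.cos (104 / 50)) / (10 * Real.pi * ((1 / 68) * Real.exp (-((109 / 50) ^ 2 * β / 5)))) :=
          div_le_div_of_nonneg_left (Real.exp_pos _).le hm0' (mul_le_mul_of_nonneg_left hm_ge (by positivity))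
      _ = 68 * Real.exp (β * Real.cos (104 / 50) + (109 / 50) ^ 2 * β / 5) / (10 * Real.pi) := by
          rw [Real.exp_add, Real.exp_neg]
          field_simp
      _ ≤ 3 * Real.exp (β * Real.cos (3 / 10) - 2 / 5 * β) / (10 * Real.pi) :=
          div_le_div_of_nonneg_right hPQ (by positivity)
      _ = Real.exp (-((2 / 5) * β)) * (3 / (10 * Real.pi) * Real.exp (β * Real.cos (3 / 10))) := by
          rw [sub_eq_add_neg, Real.exp_add]; ring
      _ ≤ Real.exp (-((2 / 5) * β)) * Θ.real Set.univ :=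
          mul_le_mul_of_nonneg_left hΘ (Real.exp_pos _).le
  -- Step 4: assemble in `ℝ≥0∞`
  calc Θ {t : ℝ | a < t}
      ≤ ∫⁻ t, ENNReal.ofReal (arcMass t / m) ∂Θ := step1
    _ = ∫⁻ t, (ENNReal.ofReal (1 / (2 * Real.pi * m)) *
          ∫⁻ θ in J, ENNReal.ofReal (circleHeatKernel t (Circle.exp θ))) ∂Θ :=
        lintegral_congr_ae (by filter_upwards [hmix.ae_pos] with t ht; exact step2 t ht)
    _ = ENNReal.ofReal (1 / (2 * Real.pi * m)) *
          ∫⁻ t, (∫⁻ θ in J, ENNReal.ofReal (circleHeatKernel t (Circle.exp θ))) ∂Θ :=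
        lintegral_const_mul' _ _ ENNReal.ofReal_ne_top
    _ = ENNReal.ofReal (1 / (2 * Real.pi * m)) * ∫⁻ θ in J, ENNReal.ofReal (Real.exp (β * Real.cos θ)) := by
        rw [lintegral_lintegral_arc hmix hJm]
    _ ≤ ENNReal.ofReal (1 / (2 * Real.pi * m)) * (ENNReal.ofReal (Real.exp (β * Real.cos (104 / 50))) * volume J) := by
        gcongr
        calc ∫⁻ θ in J, ENNReal.ofReal (Real.exp (β * Real.cos θ))
            ≤ ∫⁻ θ in J, ENNReal.ofReal (Real.exp (β * Real.cos (104 / 50))) :=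
              setLIntegral_mono' hJm (fun θ hθ => ENNReal.ofReal_le_ofReal
                (Real.exp_le_exp.2 (mul_le_mul_of_nonneg_left (cos_le_on_arc hθ) hβ0.le)))
          _ = ENNReal.ofReal (Real.exp (β * Real.cos (104 / 50))) * volume J := setLIntegral_const _ _
    _ ≤ ENNReal.ofReal (1 / (2 * Real.pi * m)) * (ENNReal.ofReal (Real.exp (β * Real.cos (104 / 50))) * ENNReal.ofReal (1 / 5)) := by
        gcongr
    _ = ENNReal.ofReal (Real.exp (β * Real.cos (104 / 50)) / (10 * Real.pi * m)) := by
        rw [← ENNReal.ofReal_mul (Real.exp_pos _).le, ← ENNReal.ofReal_mul (by positivity)]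
        congr 1
        field_simp
        ring
    _ ≤ ENNReal.ofReal (Real.exp (-((2 / 5) * β)) * Θ.real Set.univ) := ENNReal.ofReal_le_ofReal hreal
    _ = ENNReal.ofReal (Real.exp (-((2 / 5) * β))) * Θ Set.univ := by
        rw [ENNReal.ofReal_mul (Real.exp_pos _).le, ofReal_measureReal (measure_ne_top Θ _)]

end Tail

end Summit.QuantumFields.YangMills.Cruxes.HartmanWatsonMixture

end
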